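import Literature.NumberTheory.LFunctions.SiegelZeroExceptionalPrimesSecond
import Literature.NumberTheory.LFunctions.MertensFormula
import Literature.NumberTheory.LFunctions.HallTenenbaumTheorem01
import Literature.NumberTheory.LFunctions.SmoothEulerProductSandwich
import HarnessLib

/-!
# Matomäki–Merikoski, Lemma 4.1 (as printed, all `η ≥ 10`), and the divisor sum over rough numbers

Sibling of `Literature/Barriers/Parity/SiegelZeroPrimePairs.lean` (the catalogue entry vendoring
Matomäki–Merikoski, *Siegel zeros, twin primes, Goldbach's conjecture, and primes in short
intervals* (IMRN 2023; arXiv:2112.11412), Theorem 1.3 as the named fact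
`Literature.Barriers.Parity.MatomakiMerikoski2023_pairCorrelation`) and of
`SiegelZeroPrimePairsRoughSums.lean` (Lemma 2.2 of the source, PROVED there, whose proof inlines
the cover-summed form of Lemma 4.1 over Tao–Teräväinen's exceptional primes for `η ≥ η₀`).
This file records, as theorems (no definition, no named fact):

* `MatomakiMerikoski2023_lemma41_i`, `MatomakiMerikoski2023_lemma41_ii` — **Lemma 4.1 as
  printed**, both bounds, for `λ = 1 ∗ χ` ((2.3); the real part of Mathlib's
  `DirichletCharacter.zetaMul`) and for EVERY `η ≥ 10` ("We may assume that `η` is large since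
  otherwise the claims are trivial"): for a primitive quadratic `χ` mod `q` with
  `L(1 − 1/(η log q), χ) = 0` and `δ > 0`,
  `∑_{q^{1/2+δ} < p ≤ Y} λ(p)/p ≤ K_δ log Y/(η log q)` (`Y > q^{1/2+δ}`) and
  `∑_{q^{(1/2+δ)/k} < p ≤ q^{(1/2+δ)/(k−1)}} λ(p)/p ≤ K_δ k/η^{1/k}` (`k ≥ 2`). PROVED from the
  tree's proved Tao–Teräväinen Proposition 3.5
  (`Literature.NumberTheory.LFunctions.SiegelZero.TaoTeravainen2021_eq313_holds`, `…_eq314_holds`,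
  with `ε = 2δ`): `λ(p) = 1 + χ(p) ≤ 2·1_{χ(p) ≠ −1}`
  (`MatomakiMerikoski.sum_zetaMul_prime_div_le_two_mul_excPrimes`), the finitely bad range
  `10 ≤ η < η₀(δ)` being absorbed by the trivial Mertens bound
  (`MatomakiMerikoski.sum_zetaMul_prime_div_window_le`). These are the forms quoted again in §6
  (proof of Lemma 2.4) and §7 of the source.
* `MatomakiMerikoski.sum_rough_card_divisors_div_le` — the instance of (3.1)–(3.2) (§3.1:
  "`∑_{n ≤ X} |f(n)|/n ≪ ∏_{p ≤ X}(1 + |f(p)|/p)`" for divisor-bounded multiplicative `f`, and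
  Mertens "`∏_{w < p ≤ z}(1 + k/p) ≍ (log z/log w)^k`") that recurs in §§4–7:
  `∑_{m ≤ Y, (m, P(z)) = 1} τ(m)/m ≤ ∏_{z ≤ p ≤ Y}(1 − 1/p)⁻² ≤ e^{52} (log Y/log z)²` for real
  `1 < z ≤ Y`, via the tree's Hall–Tenenbaum (0.4)
  (`Literature.NumberTheory.LFunctions.HallTenenbaum.sum_div_le_prod_tsum`) and Mertens' second
  theorem with rate (`Literature.NumberTheory.LFunctions.Mertens.abs_primeRecipSum_sub_le`), in the
  window form `MatomakiMerikoski.sum_inv_primes_window_le`: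
  `∑_{z ≤ p ≤ Y} 1/p ≤ log(log Y/log z) + 24` (`1 < z ≤ Y`).

"`(m, P(z)) = 1`" (`P(z) = ∏_{p < z} p`) is rendered as "every prime factor of `m` is `≥ z`", as
in `SiegelZeroPrimePairsRoughSums.lean`. Constants are explicit but not optimised.

Coordination note (two literature seats reduce Corollary 1.1 (i) and (ii) to Theorem 1.3 and work
its inputs bottom-up): the seat writing this file continues with §3.2 of the source (Lemmas 3.2–3.3,
the `β`-sieve weights, on the tree's `Literature.NumberTheory.Sieve.BetaSieve`) and then the
identities (2.4)–(2.6) of §2; it does not take up Lemma 2.4, Proposition 2.3 or §7.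

## References

* K. Matomäki, J. Merikoski, *Siegel zeros, twin primes, Goldbach's conjecture, and primes in
  short intervals*, IMRN 2023:23, 20337–20384 (arXiv:2112.11412): Lemma 4.1 and its proof (§4),
  (3.1)–(3.2) (§3.1), (2.3) (§2); read in the held text (`lit read arxiv:2112.11412`, chunks
  p0007, p0009, p0014). [cite: MatomakiMerikoski2023, Lemma 4.1]
* T. Tao, J. Teräväinen, *The Hardy–Littlewood–Chowla conjecture in the presence of a Siegel
  zero*, J. London Math. Soc. 106 (2022), Proposition 3.5 (3.13)–(3.14) (the tree's
  `SiegelZeroExceptionalPrimes*.lean`). [cite: TaoTeravainen2021, Proposition 3.5]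
* R. R. Hall, G. Tenenbaum, *Divisors*, CUP 1988, (0.4) (tree: `HallTenenbaumTheorem01.lean`).
  [cite: HallTenenbaum1988, (0.4)]
* G. H. Hardy, E. M. Wright, *An Introduction to the Theory of Numbers*, Thm 427 (Mertens' second
  theorem; tree: `MertensFormula.lean`, `MertensElementary.lean`). [cite: HardyWright2008, Thm 427]
-/

noncomputable section

open Finset Real

namespace Literature.Barriers.Parity.MatomakiMerikoski

open Literature.NumberTheory.LFunctions

/-! ### Mertens over a window of primes -/

/-- The primes of the real interval `[z, Y]` inside `Nat.primesLE ⌊Y⌋₊`: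
`{p ∈ primesLE ⌊Y⌋ : z ≤ p} = {p ∈ [⌈z⌉, ⌊Y⌋] : p prime}`. [folklore] -/
theorem primesLE_filter_le_eq_Icc_filter (z Y : ℝ) :
    (Nat.primesLE ⌊Y⌋₊).filter (fun p : ℕ => z ≤ (p : ℝ)) = (Icc ⌈z⌉₊ ⌊Y⌋₊).filter Nat.Prime := by
  ext p
  simp only [mem_filter, Nat.mem_primesLE, mem_Icc, Nat.ceil_le]
  tauto

/-- **Mertens' second theorem over a window** (from Hardy–Wright Thm 427 with the rate `8/log x`
proved in the tree, `Mertens.abs_primeRecipSum_sub_le`): for real `1 < z ≤ Y`,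
`∑_{z ≤ p ≤ Y} 1/p ≤ log(log Y/log z) + 24`. [cite: HardyWright2008, Thm 427 (§22.7)] -/
theorem sum_inv_primes_window_le {z Y : ℝ} (hz : 1 < z) (hzY : z ≤ Y) :
    ∑ p ∈ (Icc ⌈z⌉₊ ⌊Y⌋₊).filter Nat.Prime, (1 : ℝ) / p ≤
      Real.log (Real.log Y / Real.log z) + 24 := by
  have hlogz : 0 < Real.log z := Real.log_pos hz
  have hY1 : 1 < Y := lt_of_lt_of_le hz hzY
  have hlogY : 0 < Real.log Y := Real.log_pos hY1
  have hlogzY : Real.log z ≤ Real.log Y := Real.log_le_log (by linarith) hzY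
  have hU1 : 1 ≤ Real.log Y / Real.log z := by rwa [le_div_iff₀ hlogz, one_mul]
  have hlogU : 0 ≤ Real.log (Real.log Y / Real.log z) := Real.log_nonneg hU1
  by_cases hY2 : Y < 2
  · -- no primes `≤ Y`
    have hempty : (Icc ⌈z⌉₊ ⌊Y⌋₊).filter Nat.Prime = ∅ := by
      refine filter_false_of_mem fun p hp => ?_
      have hp1 : p ≤ 1 := by
        have : p ≤ ⌊Y⌋₊ := (mem_Icc.mp hp).2
        have h2 : ⌊Y⌋₊ < 2 := (Nat.floor_lt (by linarith)).mpr (by exact_mod_cast hY2)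
        omega
      exact fun h => absurd hp1 (not_le.mpr h.one_lt)
    rw [hempty, sum_empty]
    linarith
  push Not at hY2
  rw [Real.log_div hlogY.ne' hlogz.ne']
  by_cases hz2 : z ≤ 2
  · -- all primes `≤ Y`
    have hY2' : 2 ≤ ⌊Y⌋₊ := Nat.le_floor (by exact_mod_cast hY2)
    have hsub : (Icc ⌈z⌉₊ ⌊Y⌋₊).filter Nat.Prime ⊆ Nat.primesLE ⌊Y⌋₊ := by
      intro p hp
      simp only [mem_filter, mem_Icc] at hp
      exact Nat.mem_primesLE.mpr ⟨hp.1.2, hp.2⟩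
    have h1 : ∑ p ∈ (Icc ⌈z⌉₊ ⌊Y⌋₊).filter Nat.Prime, (1 : ℝ) / p ≤
        Real.log (Real.log ⌊Y⌋₊) + 4 :=
      (sum_le_sum_of_subset_of_nonneg hsub fun p _ _ => by positivity).trans
        (MertensBound.sum_inv_prime_le ⌊Y⌋₊ hY2')
    have h2 : Real.log (Real.log ⌊Y⌋₊) ≤ Real.log (Real.log Y) := by
      have hf2 : (2 : ℝ) ≤ ⌊Y⌋₊ := by exact_mod_cast hY2'
      have hfY : (⌊Y⌋₊ : ℝ) ≤ Y := Nat.floor_le (by linarith)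
      exact Real.log_le_log (Real.log_pos (by linarith)) (Real.log_le_log (by linarith) hfY)
    -- `log log z ≤ log log 2 ≤ 0`
    have h3 : Real.log (Real.log z) ≤ 0 := by
      apply Real.log_nonpos hlogz.le
      calc Real.log z ≤ Real.log 2 := Real.log_le_log (by linarith) hz2
        _ ≤ 1 := by linarith [Real.log_two_lt_d9]
    linarith
  push Not at hz2
  -- `2 < z ≤ Y`: difference of two Mertens sums plus the possible prime `⌊z⌋`
  have hz2' : 2 ≤ ⌊z⌋₊ := Nat.le_floor (by exact_mod_cast hz2.le)
  have hfz0 : (0 : ℝ) < ⌊z⌋₊ := by exact_mod_cast (show 0 < ⌊z⌋₊ by omega)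
  have hsub : (Icc ⌈z⌉₊ ⌊Y⌋₊).filter Nat.Prime ⊆
      insert ⌊z⌋₊ (Nat.primesLE ⌊Y⌋₊ \ Nat.primesLE ⌊z⌋₊) := by
    intro p hp
    simp only [mem_filter, mem_Icc] at hp
    rw [mem_insert, mem_sdiff, Nat.mem_primesLE, Nat.mem_primesLE]
    by_cases hpz : p = ⌊z⌋₊
    · exact Or.inl hpz
    · refine Or.inr ⟨⟨hp.1.2, hp.2⟩, fun h => hpz ?_⟩
      have := Nat.floor_le_ceil z
      omega
  have hdiff : ∑ p ∈ Nat.primesLE ⌊Y⌋₊ \ Nat.primesLE ⌊z⌋₊, (1 : ℝ) / p =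
      Mertens.primeRecipSum Y - Mertens.primeRecipSum z := by
    have hsubset : Nat.primesLE ⌊z⌋₊ ⊆ Nat.primesLE ⌊Y⌋₊ := by
      intro p hp
      rw [Nat.mem_primesLE] at hp ⊢
      exact ⟨hp.1.trans (Nat.floor_le_floor hzY), hp.2⟩
    rw [eq_sub_iff_add_eq]
    unfold Mertens.primeRecipSum
    simp_rw [one_div]
    exact sum_sdiff hsubset
  have hMY := Mertens.abs_primeRecipSum_sub_le hY2
  have hMz := Mertens.abs_primeRecipSum_sub_le hz2.le
  rw [abs_le] at hMY hMz
  have hlog2 : Real.log 2 ≤ Real.log z := Real.log_le_log (by norm_num) hz2.le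
  have hlog2Y : Real.log 2 ≤ Real.log Y := hlog2.trans hlogzY
  have hl2 : (0.69 : ℝ) < Real.log 2 := by linarith [Real.log_two_gt_d9]
  have h8z : 8 / Real.log z ≤ 8 / 0.69 := by
    apply div_le_div_of_nonneg_left (by norm_num) (by norm_num); linarith
  have h8Y : 8 / Real.log Y ≤ 8 / 0.69 := by
    apply div_le_div_of_nonneg_left (by norm_num) (by norm_num); linarith
  have hins : ∑ p ∈ insert ⌊z⌋₊ (Nat.primesLE ⌊Y⌋₊ \ Nat.primesLE ⌊z⌋₊), (1 : ℝ) / p ≤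
      1 / (⌊z⌋₊ : ℝ) + ∑ p ∈ Nat.primesLE ⌊Y⌋₊ \ Nat.primesLE ⌊z⌋₊, (1 : ℝ) / p := by
    by_cases hmem : ⌊z⌋₊ ∈ Nat.primesLE ⌊Y⌋₊ \ Nat.primesLE ⌊z⌋₊
    · rw [insert_eq_of_mem hmem]
      linarith [show (0 : ℝ) ≤ 1 / (⌊z⌋₊ : ℝ) by positivity]
    · rw [sum_insert hmem]
  have hhalf : 1 / (⌊z⌋₊ : ℝ) ≤ 1 / 2 := by
    apply div_le_div_of_nonneg_left (by norm_num) (by norm_num)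
    exact_mod_cast hz2'
  calc ∑ p ∈ (Icc ⌈z⌉₊ ⌊Y⌋₊).filter Nat.Prime, (1 : ℝ) / p
      ≤ ∑ p ∈ insert ⌊z⌋₊ (Nat.primesLE ⌊Y⌋₊ \ Nat.primesLE ⌊z⌋₊), (1 : ℝ) / p :=
        sum_le_sum_of_subset_of_nonneg hsub fun p _ _ => by positivity
    _ ≤ 1 / (⌊z⌋₊ : ℝ) + (Mertens.primeRecipSum Y - Mertens.primeRecipSum z) := by
        rw [← hdiff]; exact hins
    _ ≤ Real.log (Real.log Y) - Real.log (Real.log z) + 24 := by nlinarith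

/-- `∑_{p prime, p ≥ n} 1/p² ≤ ∑_{k ≥ n} 1/k² ≤ 2/n`: for `2 ≤ n ≤ N`,
`∑_{k ∈ [n, N]} 1/k² ≤ 2/n` (telescoping `1/k² ≤ 1/(k-1) - 1/k`). [folklore] -/
theorem sum_Icc_inv_sq_le {n N : ℕ} (hn : 2 ≤ n) :
    ∑ k ∈ Icc n N, (1 : ℝ) / (k : ℝ) ^ 2 ≤ 2 / n := by
  have key : ∀ N : ℕ, ∑ k ∈ Icc n N, (1 : ℝ) / (k : ℝ) ^ 2 ≤ 1 / ((n : ℝ) - 1) - 1 / N ∨ N < n := by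
    intro N
    induction N with
    | zero => exact Or.inr (by omega)
    | succ N ih =>
      by_cases hN : N + 1 < n
      · exact Or.inr hN
      · left
        push Not at hN
        rcases ih with ih | ih
        · rw [sum_Icc_succ_top (by omega)]
          have hN0 : (1 : ℝ) ≤ N := by exact_mod_cast (show 1 ≤ N by omega)
          have h1 : (1 : ℝ) / ((N + 1 : ℕ) : ℝ) ^ 2 ≤ 1 / (N : ℝ) - 1 / ((N + 1 : ℕ) : ℝ) := by
            push_cast
            rw [div_sub_div _ _ (by positivity) (by positivity), div_le_div_iff₀ (by positivity)
              (by positivity)]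
            nlinarith
          linarith
        · -- `N + 1 = n`
          have hNn : N + 1 = n := by omega
          rw [hNn, Icc_self, sum_singleton]
          have hn1 : (1 : ℝ) ≤ (n : ℝ) - 1 := by
            have : (2 : ℝ) ≤ n := by exact_mod_cast hn
            linarith
          rw [div_sub_div _ _ (by positivity) (by positivity), div_le_div_iff₀ (by positivity)
              (by positivity)]
          nlinarith
  have hn0 : (0 : ℝ) < n := by exact_mod_cast (show 0 < n by omega)
  have hn1 : (1 : ℝ) ≤ (n : ℝ) - 1 := by
    have : (2 : ℝ) ≤ n := by exact_mod_cast hn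
    linarith
  rcases key N with h | h
  · have hN0 : (0 : ℝ) ≤ 1 / (N : ℝ) := by positivity
    have h2 : 1 / ((n : ℝ) - 1) ≤ 2 / n := by
      rw [div_le_div_iff₀ (by linarith) hn0]; nlinarith
    linarith
  · rw [Icc_eq_empty (by omega), sum_empty]; positivity

/-! ### Divisor sums over rough numbers -/

/-- `∑_ν (ν + 1) t^ν = (1 - t)⁻²` for `0 ≤ t < 1`. [folklore] -/
theorem hasSum_succ_mul_pow {t : ℝ} (ht0 : 0 ≤ t) (ht1 : t < 1) :
    HasSum (fun ν : ℕ => ((ν : ℝ) + 1) * t ^ ν) ((1 - t)⁻¹ ^ 2) := by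
  have ht : ‖t‖ < 1 := by rwa [Real.norm_eq_abs, abs_of_nonneg ht0]
  have h1 := hasSum_coe_mul_geometric_of_norm_lt_one ht
  have h2 := hasSum_geometric_of_lt_one ht0 ht1
  have h1t : (1 : ℝ) - t ≠ 0 := by linarith
  have h := h1.add h2
  have hfun : (fun ν : ℕ => ((ν : ℝ) + 1) * t ^ ν) = fun n : ℕ => (n : ℝ) * t ^ n + t ^ n := by
    funext n; ring
  rw [hfun, show (1 - t)⁻¹ ^ 2 = t / (1 - t) ^ 2 + (1 - t)⁻¹ by field_simp; ring]
  exact h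

/-- `(1 - 1/p)⁻² ≤ exp(2/p + 4/p²)` for `p ≥ 2` (from `-log(1 - x) ≤ x + 2x²` on `[0, 1/2]`).
[folklore] -/
theorem inv_one_sub_inv_sq_le_exp {p : ℝ} (hp : 2 ≤ p) :
    (1 - p⁻¹)⁻¹ ^ 2 ≤ Real.exp (2 / p + 4 / p ^ 2) := by
  have hp0 : 0 < p := by linarith
  set x : ℝ := p⁻¹ with hx
  have hx0 : 0 < x := inv_pos.mpr hp0
  have hx2 : x ≤ 1 / 2 := by rw [hx, inv_eq_one_div]; exact div_le_div_of_nonneg_left (by norm_num) (by norm_num) hp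
  have hx1 : |x| < 1 := by rw [abs_of_pos hx0]; linarith
  -- `|x + log(1 - x)| ≤ x²/(1 - x) ≤ 2x²`
  have hser := Real.abs_log_sub_add_sum_range_le hx1 1
  simp only [Finset.sum_range_one, Nat.cast_zero, zero_add, pow_one, div_one] at hser
  rw [abs_of_pos hx0] at hser
  have hlog : -Real.log (1 - x) ≤ x + 2 * x ^ 2 := by
    have h1 : x ^ (1 + 1) / (1 - x) ≤ 2 * x ^ 2 := by
      rw [show (1 + 1 : ℕ) = 2 from rfl, div_le_iff₀ (by linarith)]
      nlinarith [mul_nonneg (sq_nonneg x) (show (0 : ℝ) ≤ 1 - 2 * x by linarith)]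
    have := (abs_le.mp (hser.trans h1)).1
    linarith
  have hpos : 0 < 1 - x := by linarith
  calc (1 - x)⁻¹ ^ 2 = Real.exp (-Real.log (1 - x)) ^ 2 := by
        rw [Real.exp_neg, Real.exp_log hpos]
    _ = Real.exp (2 * -Real.log (1 - x)) := by rw [← Real.exp_nat_mul]; norm_num
    _ ≤ Real.exp (2 * (x + 2 * x ^ 2)) := Real.exp_le_exp.mpr (by linarith)
    _ = Real.exp (2 / p + 4 / p ^ 2) := by
        congr 1; rw [hx]; field_simp; ring

/-- **The divisor function over rough numbers** ((3.1)–(3.2) of the source in the case used in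
§4: "`∑_{n ≤ X} |f(n)|/n ≪ ∏_{p ≤ X}(1 + |f(p)|/p)`" and Mertens): for real `1 < z ≤ Y`,
`∑_{m ≤ Y, (m, P(z)) = 1} τ(m)/m ≤ ∏_{z ≤ p ≤ Y} (1 - 1/p)⁻² ≤ e^{52} (log Y/log z)²`.
[cite: MatomakiMerikoski2023, §3.1 (3.1)–(3.2)] -/
theorem sum_rough_card_divisors_div_le {z Y : ℝ} (hz : 1 < z) (hzY : z ≤ Y) :
    ∑ m ∈ (Icc 1 ⌊Y⌋₊).filter (fun m : ℕ => ∀ p ∈ m.primeFactors, z ≤ (p : ℝ)),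
        (m.divisors.card : ℝ) / m ≤ Real.exp 52 * (Real.log Y / Real.log z) ^ 2 := by
  classical
  have hlogz : 0 < Real.log z := Real.log_pos hz
  have hY1 : 1 < Y := lt_of_lt_of_le hz hzY
  have hlogY : 0 < Real.log Y := Real.log_pos hY1
  set X : ℕ := ⌊Y⌋₊ with hX
  -- the multiplicative function `τ · 1_{z-rough}`
  set f : ℕ → ℝ := fun n => if ∀ p ∈ n.primeFactors, z ≤ (p : ℝ) then (n.divisors.card : ℝ) else 0
    with hf
  have hf0 : ∀ n, 0 ≤ f n := fun n => by
    simp only [hf]; split_ifs <;> positivity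
  have hf1 : f 1 = 1 := by simp [hf, Nat.not_prime_one]
  have hmul : ∀ m n, Nat.Coprime m n → f (m * n) = f m * f n := by
    intro m n hmn
    rcases Nat.eq_zero_or_pos m with rfl | hm
    · simp [hf]
    rcases Nat.eq_zero_or_pos n with rfl | hn
    · simp [hf]
    simp only [hf, Nat.primeFactors_mul hm.ne' hn.ne', Finset.mem_union]
    by_cases hpm : ∀ p ∈ m.primeFactors, z ≤ (p : ℝ)
    · by_cases hpn : ∀ p ∈ n.primeFactors, z ≤ (p : ℝ)
      · rw [if_pos (fun p hp => hp.elim (hpm p) (hpn p)), if_pos hpm, if_pos hpn,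
          Nat.Coprime.card_divisors_mul hmn, Nat.cast_mul]
      · rw [if_neg (fun h => hpn fun p hp => h p (Or.inr hp)), if_neg hpn, mul_zero]
    · rw [if_neg (fun h => hpm fun p hp => h p (Or.inl hp)), if_neg hpm, zero_mul]
  -- values at prime powers
  have hfpow_le : ∀ p : ℕ, p.Prime → ∀ ν : ℕ, f (p ^ ν) ≤ (ν : ℝ) + 1 := by
    intro p hp ν
    simp only [hf]
    split_ifs
    · rw [Nat.divisors_prime_pow hp, Finset.card_map, Finset.card_range]; push_cast; rfl
    · positivity
  have hfpow_rough : ∀ p : ℕ, p.Prime → z ≤ (p : ℝ) → ∀ ν : ℕ, f (p ^ ν) = (ν : ℝ) + 1 := by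
    intro p hp hzp ν
    simp only [hf]
    rw [if_pos, Nat.divisors_prime_pow hp, Finset.card_map, Finset.card_range]
    · push_cast; rfl
    · intro r hr
      rcases Nat.eq_zero_or_pos ν with rfl | hν
      · simp at hr
      · rw [Nat.primeFactors_prime_pow hν.ne' hp, Finset.mem_singleton] at hr
        rw [hr]; exact hzp
  have hfpow_small : ∀ p : ℕ, p.Prime → (p : ℝ) < z → ∀ ν : ℕ, f (p ^ ν) = if ν = 0 then 1 else 0 := by
    intro p hp hzp ν
    rcases Nat.eq_zero_or_pos ν with rfl | hν
    · simp [hf1]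
    · rw [if_neg hν.ne']
      simp only [hf]
      rw [if_neg]
      intro h
      have := h p (by rw [Nat.primeFactors_prime_pow hν.ne' hp]; exact Finset.mem_singleton_self p)
      linarith
  -- the local series
  have hgeom : ∀ p : ℕ, p.Prime →
      HasSum (fun ν : ℕ => ((ν : ℝ) + 1) / (p : ℝ) ^ ν) ((1 - (p : ℝ)⁻¹)⁻¹ ^ 2) := by
    intro p hp
    have hp1 : (1 : ℝ) < p := by exact_mod_cast hp.one_lt
    have h := hasSum_succ_mul_pow (t := (p : ℝ)⁻¹) (by positivity) (inv_lt_one_of_one_lt₀ hp1)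
    convert h using 1
    funext ν; rw [inv_pow, div_eq_mul_inv]
  have hsum : ∀ p : ℕ, p.Prime → Summable (fun ν : ℕ => f (p ^ ν) / (p : ℝ) ^ ν) := by
    intro p hp
    refine Summable.of_nonneg_of_le (fun ν => by have := hf0 (p ^ ν); positivity)
      (fun ν => ?_) (hgeom p hp).summable
    exact div_le_div_of_nonneg_right (hfpow_le p hp ν) (by positivity)
  have htsum_rough : ∀ p : ℕ, p.Prime → z ≤ (p : ℝ) →
      ∑' ν : ℕ, f (p ^ ν) / (p : ℝ) ^ ν = (1 - (p : ℝ)⁻¹)⁻¹ ^ 2 := by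
    intro p hp hzp
    simp_rw [hfpow_rough p hp hzp]
    exact (hgeom p hp).tsum_eq
  have htsum_small : ∀ p : ℕ, p.Prime → (p : ℝ) < z → ∑' ν : ℕ, f (p ^ ν) / (p : ℝ) ^ ν = 1 := by
    intro p hp hzp
    simp_rw [hfpow_small p hp hzp]
    rw [tsum_eq_single 0 (fun ν hν => by rw [if_neg hν, zero_div])]
    simp
  -- Hall–Tenenbaum (0.4)
  have hHT := HallTenenbaum.sum_div_le_prod_tsum hf1 hmul hf0 hsum X
  have hlhs : ∑ m ∈ (Icc 1 X).filter (fun m : ℕ => ∀ p ∈ m.primeFactors, z ≤ (p : ℝ)),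
      (m.divisors.card : ℝ) / m = ∑ n ∈ Icc 1 X, f n / n := by
    rw [Finset.sum_filter]
    refine Finset.sum_congr rfl fun n _ => ?_
    simp only [hf]
    split_ifs <;> simp
  have hrhs : ∏ p ∈ Nat.primesLE X, ∑' ν : ℕ, f (p ^ ν) / (p : ℝ) ^ ν =
      ∏ p ∈ (Nat.primesLE X).filter (fun p : ℕ => z ≤ (p : ℝ)), (1 - (p : ℝ)⁻¹)⁻¹ ^ 2 := by
    rw [Finset.prod_filter]
    refine Finset.prod_congr rfl fun p hp => ?_
    have hp' := (Nat.mem_primesLE.mp hp).2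
    split_ifs with h
    · exact htsum_rough p hp' h
    · exact htsum_small p hp' (lt_of_not_ge h)
  rw [hlhs]
  refine hHT.trans ?_
  rw [hrhs, primesLE_filter_le_eq_Icc_filter]
  -- the product of local factors
  set s := (Icc ⌈z⌉₊ ⌊Y⌋₊).filter Nat.Prime with hs
  have hmem : ∀ p ∈ s, (2 : ℝ) ≤ p := fun p hp => by
    exact_mod_cast (Finset.mem_filter.mp hp).2.two_le
  have h1 : ∏ p ∈ s, (1 - (p : ℝ)⁻¹)⁻¹ ^ 2 ≤ ∏ p ∈ s, Real.exp (2 / p + 4 / (p : ℝ) ^ 2) := by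
    refine Finset.prod_le_prod (fun p _ => by positivity) fun p hp => inv_one_sub_inv_sq_le_exp (hmem p hp)
  have h2 : ∏ p ∈ s, Real.exp (2 / p + 4 / (p : ℝ) ^ 2) =
      Real.exp (2 * ∑ p ∈ s, (1 : ℝ) / p + 4 * ∑ p ∈ s, (1 : ℝ) / (p : ℝ) ^ 2) := by
    rw [← Real.exp_sum, Finset.mul_sum, Finset.mul_sum, ← Finset.sum_add_distrib]
    congr 1
    refine Finset.sum_congr rfl fun p _ => ?_
    ring
  have h3 : ∑ p ∈ s, (1 : ℝ) / (p : ℝ) ^ 2 ≤ 1 := by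
    have hsub : s ⊆ Icc 2 ⌊Y⌋₊ := by
      intro p hp
      have hp' := Finset.mem_filter.mp hp
      exact Finset.mem_Icc.mpr ⟨hp'.2.two_le, (Finset.mem_Icc.mp hp'.1).2⟩
    calc ∑ p ∈ s, (1 : ℝ) / (p : ℝ) ^ 2 ≤ ∑ p ∈ Icc 2 ⌊Y⌋₊, (1 : ℝ) / (p : ℝ) ^ 2 :=
          Finset.sum_le_sum_of_subset_of_nonneg hsub fun p _ _ => by positivity
      _ ≤ 2 / (2 : ℕ) := sum_Icc_inv_sq_le le_rfl
      _ = 1 := by norm_num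
  have h4 := sum_inv_primes_window_le hz hzY
  have hU : 0 < Real.log Y / Real.log z := div_pos hlogY hlogz
  calc ∏ p ∈ s, (1 - (p : ℝ)⁻¹)⁻¹ ^ 2 ≤ ∏ p ∈ s, Real.exp (2 / p + 4 / (p : ℝ) ^ 2) := h1
    _ = Real.exp (2 * ∑ p ∈ s, (1 : ℝ) / p + 4 * ∑ p ∈ s, (1 : ℝ) / (p : ℝ) ^ 2) := h2
    _ ≤ Real.exp (2 * (Real.log (Real.log Y / Real.log z) + 24) + 4 * 1) := by
        apply Real.exp_le_exp.mpr; nlinarith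
    _ = Real.exp 52 * (Real.log Y / Real.log z) ^ 2 := by
        have hexp : Real.exp (2 * Real.log (Real.log Y / Real.log z)) =
            (Real.log Y / Real.log z) ^ 2 := by
          rw [show (2 : ℝ) * Real.log (Real.log Y / Real.log z) =
              Real.log ((Real.log Y / Real.log z) ^ 2) by rw [Real.log_pow]; norm_num,
            Real.exp_log (by positivity)]
        rw [show 2 * (Real.log (Real.log Y / Real.log z) + 24) + 4 * 1 =
          52 + 2 * Real.log (Real.log Y / Real.log z) by ring, Real.exp_add, hexp]

/-! ### `λ = 1 ∗ χ` at primes and the exceptional primes of Tao–Teräväinen -/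

section lambda

variable {q : ℕ} (χ : DirichletCharacter ℂ q)

/-- `λ(p) = (1 ∗ χ)(p) = 1 + χ(p)` at a prime (real parts; `χ` quadratic); a private copy of
`MatomakiMerikoski.zetaMul_prime_re` of `SiegelZeroPrimePairsRoughSums.lean`. [cite: MatomakiMerikoski2023, §2 (2.3)] -/
private theorem zetaMul_prime_re' (hχ : χ ^ 2 = 1) {p : ℕ} (hp : p.Prime) :
    (χ.zetaMul p).re = 1 + (χ p).re := by
  have h := SmoothEulerProduct.zetaMul_prime_pow_re χ hχ hp 1
  rw [pow_one] at h
  rw [h, Finset.sum_range_succ, Finset.sum_range_one, pow_zero, pow_one]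

/-- At a prime, `0 ≤ λ(p) ≤ 2·1_{χ(p) ≠ -1}`: `λ(p)` vanishes unless `p` is exceptional in the sense
of Tao–Teräväinen (`χ(p) ≠ -1`), and is at most `2`. [cite: MatomakiMerikoski2023, §4 (proof of Lemma 4.1)] -/
theorem zetaMul_prime_re_le_two_mul_indicator (hχ : χ ^ 2 = 1) {p : ℕ} (hp : p.Prime) :
    (χ.zetaMul p).re ≤ 2 * (if χ (p : ZMod q) ≠ -1 then 1 else 0) := by
  rw [zetaMul_prime_re' χ hχ hp]
  split_ifs with h
  · linarith [(abs_le.mp (SmoothEulerProduct.abs_apply_re_le_one χ p)).2]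
  · push Not at h
    rw [h]; norm_num

/-- `∑_{p ∈ S prime} λ(p)/p ≤ 2 ∑_{p* ∈ S exceptional} 1/p*`. [cite: MatomakiMerikoski2023, §4 (proof of Lemma 4.1)] -/
theorem sum_zetaMul_prime_div_le_two_mul_excPrimes (hχ : χ ^ 2 = 1) (S : Finset ℕ) :
    ∑ p ∈ S.filter Nat.Prime, (χ.zetaMul p).re / p ≤
      2 * ∑ p ∈ SiegelZero.excPrimes χ S, (1 : ℝ) / p := by
  classical
  have hexc : SiegelZero.excPrimes χ S = (S.filter Nat.Prime).filter (fun p : ℕ => χ (p : ZMod q) ≠ -1) := by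
    ext p
    rw [SiegelZero.mem_excPrimes, Finset.filter_filter, Finset.mem_filter]
  rw [hexc, Finset.sum_filter (fun p : ℕ => χ (p : ZMod q) ≠ -1), Finset.mul_sum]
  refine Finset.sum_le_sum fun p hp => ?_
  have hp' : p.Prime := (Finset.mem_filter.mp hp).2
  have hp0 : (0 : ℝ) < p := by exact_mod_cast hp'.pos
  have h := zetaMul_prime_re_le_two_mul_indicator χ hχ hp'
  by_cases hne : χ (p : ZMod q) ≠ -1
  · rw [if_pos hne] at h ⊢
    rw [mul_one] at h
    calc (χ.zetaMul p).re / p ≤ 2 / p := div_le_div_of_nonneg_right h hp0.le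
      _ = 2 * (1 / (p : ℝ)) := by ring
  · rw [if_neg hne] at h ⊢
    rw [mul_zero] at h ⊢
    have h0 : (χ.zetaMul p).re = 0 := le_antisymm h (SmoothEulerProduct.zetaMul_re_nonneg χ hχ p)
    rw [h0, zero_div]

/-- Trivial bound for a window of primes: `∑_{a < p ≤ b} λ(p)/p ≤ 2 (log(log b/log a) + 24)` for
`1 < a ≤ b`. [cite: MatomakiMerikoski2023, §4 (proof of Lemma 4.1: "otherwise the claims are trivial")] -/
theorem sum_zetaMul_prime_div_window_le (hχ : χ ^ 2 = 1) {a b : ℝ} (ha : 1 < a) (hab : a ≤ b) :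
    ∑ p ∈ (Ioc ⌊a⌋₊ ⌊b⌋₊).filter Nat.Prime, (χ.zetaMul p).re / p ≤
      2 * (Real.log (Real.log b / Real.log a) + 24) := by
  have hsub : (Ioc ⌊a⌋₊ ⌊b⌋₊).filter Nat.Prime ⊆ (Icc ⌈a⌉₊ ⌊b⌋₊).filter Nat.Prime := by
    intro p hp
    simp only [Finset.mem_filter, Finset.mem_Ioc, Finset.mem_Icc] at hp ⊢
    exact ⟨⟨(Nat.ceil_le_floor_add_one a).trans hp.1.1, hp.1.2⟩, hp.2⟩
  have hle : ∀ p ∈ (Icc ⌈a⌉₊ ⌊b⌋₊).filter Nat.Prime, (χ.zetaMul p).re / p ≤ 2 * ((1 : ℝ) / p) := by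
    intro p hp
    have hp' : p.Prime := (Finset.mem_filter.mp hp).2
    have hp0 : (0 : ℝ) < p := by exact_mod_cast hp'.pos
    have h2 : (χ.zetaMul p).re ≤ 2 :=
      (zetaMul_prime_re_le_two_mul_indicator χ hχ hp').trans (by split_ifs <;> norm_num)
    rw [mul_one_div, div_le_div_iff_of_pos_right hp0]
    exact h2
  calc ∑ p ∈ (Ioc ⌊a⌋₊ ⌊b⌋₊).filter Nat.Prime, (χ.zetaMul p).re / p
      ≤ ∑ p ∈ (Icc ⌈a⌉₊ ⌊b⌋₊).filter Nat.Prime, (χ.zetaMul p).re / p :=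
        Finset.sum_le_sum_of_subset_of_nonneg hsub fun p hp _ => by
          have hp' : p.Prime := (Finset.mem_filter.mp hp).2
          exact div_nonneg (SmoothEulerProduct.zetaMul_re_nonneg χ hχ p) (Nat.cast_nonneg p)
    _ ≤ ∑ p ∈ (Icc ⌈a⌉₊ ⌊b⌋₊).filter Nat.Prime, 2 * ((1 : ℝ) / p) := Finset.sum_le_sum hle
    _ = 2 * ∑ p ∈ (Icc ⌈a⌉₊ ⌊b⌋₊).filter Nat.Prime, (1 : ℝ) / p := by rw [Finset.mul_sum]
    _ ≤ 2 * (Real.log (Real.log b / Real.log a) + 24) := by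
        gcongr; exact sum_inv_primes_window_le ha hab

end lambda

end Literature.Barriers.Parity.MatomakiMerikoski

/-! ### Lemma 4.1 -/

namespace Literature.Barriers.Parity

open Literature.NumberTheory.LFunctions MatomakiMerikoski

/-- **Matomäki–Merikoski 2023, Lemma 4.1, first bound** ("essentially [TT, Proposition 3.5]"):
"Let `χ` be a primitive quadratic character modulo `q ≥ 2`. Assume that `L(s, χ)` has a real zero
`β₀` such that `β₀ = 1 − 1/(η log q)` for some `η ≥ 10`. Let `δ > 0`. Then, for any
`Y > q^{1/2+δ}`, one has `∑_{q^{1/2+δ} < p ≤ Y} λ(p)/p ≪_δ log Y/(η log q)`", `λ = 1 ∗ χ`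
(`λ(p) = 1 + χ(p)`, the real part of Mathlib's `DirichletCharacter.zetaMul`). PROVED from the
tree's Tao–Teräväinen Proposition 3.5 (3.13) (`SiegelZero.TaoTeravainen2021_eq313_holds`, with
`ε = 2δ`): `λ(p) ≤ 2·1_{p exceptional}`; for the finitely bad range `10 ≤ η < η₀(δ)` the claim is
trivial by Mertens ("We may assume that `η` is large since otherwise the claims are trivial").
[cite: MatomakiMerikoski2023, Lemma 4.1] -/
theorem MatomakiMerikoski2023_lemma41_i (δ : ℝ) (hδ : 0 < δ) :
    ∃ K : ℝ, 0 < K ∧ ∀ (q : ℕ) [NeZero q] (χ : DirichletCharacter ℂ q), χ.IsPrimitive →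
      χ.IsQuadratic → ∀ η : ℝ, 10 ≤ η → χ.LFunction ((1 - 1 / (η * Real.log q) : ℝ) : ℂ) = 0 →
        ∀ Y : ℝ, (q : ℝ) ^ (1 / 2 + δ) < Y →
          ∑ p ∈ (Ioc ⌊(q : ℝ) ^ (1 / 2 + δ)⌋₊ ⌊Y⌋₊).filter Nat.Prime, (χ.zetaMul p).re / p ≤
            K * Real.log Y / (η * Real.log q) := by
  obtain ⟨K₁, η₀, hTT⟩ := SiegelZero.TaoTeravainen2021_eq313_holds (2 * δ) (by positivity)
  set η₁ : ℝ := max η₀ 10 with hη₁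
  have hη₁0 : 10 ≤ η₁ := le_max_right _ _
  refine ⟨2 * |K₁| + 100 * η₁, by positivity, ?_⟩
  intro q _ χ hprim hquad η hη hL Y hY
  have hq2 : 2 ≤ q := SiegelZero.two_le_of_LFunction_eq_zero hL
  have hq1 : (1 : ℝ) < q := by exact_mod_cast hq2
  have hq0 : (0 : ℝ) < q := by linarith
  have hlogq : 0 < Real.log q := Real.log_pos hq1
  have hχ2 : χ ^ 2 = 1 := MulChar.isQuadratic_iff_sq_eq_one.mp hquad
  have hη0 : 0 < η := by linarith
  set a : ℝ := (q : ℝ) ^ (1 / 2 + δ) with ha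
  have ha1 : 1 < a := Real.one_lt_rpow hq1 (by positivity)
  have hloga : Real.log a = (1 / 2 + δ) * Real.log q := Real.log_rpow hq0 _
  have hloga0 : 0 < Real.log a := Real.log_pos ha1
  have hY1 : 1 < Y := ha1.trans hY
  have hlogY : 0 < Real.log Y := Real.log_pos hY1
  have hlogaY : Real.log a ≤ Real.log Y := Real.log_le_log (by linarith) hY.le
  -- `log Y/log q ≥ 1/2`
  have hratio : Real.log a / Real.log q ≤ Real.log Y / Real.log q :=
    div_le_div_of_nonneg_right hlogaY hlogq.le
  have hratio' : 1 / 2 ≤ Real.log Y / Real.log q := by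
    refine le_trans ?_ hratio
    rw [hloga, mul_div_assoc, div_self hlogq.ne', mul_one]; linarith
  have hpos : 0 < Real.log Y / (η * Real.log q) := by positivity
  by_cases hηlarge : η₁ ≤ η
  · -- Tao–Teräväinen (3.13)
    have h := hTT q χ hprim hquad η ((le_max_left _ _).trans hηlarge) hL Y
      (by rw [show (1 + 2 * δ) / 2 = 1 / 2 + δ by ring]; exact hY.le)
    rw [show (1 + 2 * δ) / 2 = 1 / 2 + δ by ring] at h
    calc ∑ p ∈ (Ioc ⌊a⌋₊ ⌊Y⌋₊).filter Nat.Prime, (χ.zetaMul p).re / p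
        ≤ 2 * ∑ p ∈ SiegelZero.excPrimes χ (Ioc ⌊a⌋₊ ⌊Y⌋₊), (1 : ℝ) / p :=
          sum_zetaMul_prime_div_le_two_mul_excPrimes χ hχ2 _
      _ ≤ 2 * (K₁ * (Real.log Y / Real.log q) / η) := by gcongr
      _ ≤ 2 * |K₁| * Real.log Y / (η * Real.log q) := by
          rw [show 2 * (K₁ * (Real.log Y / Real.log q) / η) = 2 * K₁ * (Real.log Y / (η * Real.log q)) by
            field_simp, mul_div_assoc]
          gcongr; exact le_abs_self K₁
      _ ≤ (2 * |K₁| + 100 * η₁) * Real.log Y / (η * Real.log q) := by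
          rw [mul_div_assoc, mul_div_assoc]; gcongr; nlinarith
  · -- trivial range `10 ≤ η < η₁`
    push Not at hηlarge
    have htriv := sum_zetaMul_prime_div_window_le χ hχ2 ha1 hY.le
    -- `log(log Y/log a) ≤ log Y/log a ≤ 2 log Y/log q` and `24 ≤ 48 log Y/log q`
    have hU : Real.log (Real.log Y / Real.log a) ≤ Real.log Y / Real.log a :=
      (Real.log_le_sub_one_of_pos (div_pos hlogY hloga0)).trans (by linarith)
    have hU2 : Real.log Y / Real.log a ≤ 2 * (Real.log Y / Real.log q) := by
      rw [hloga, div_le_iff₀ (by positivity)]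
      have : Real.log Y / Real.log q * Real.log q = Real.log Y := div_mul_cancel₀ _ hlogq.ne'
      nlinarith
    have hfin : ∑ p ∈ (Ioc ⌊a⌋₊ ⌊Y⌋₊).filter Nat.Prime, (χ.zetaMul p).re / p ≤
        100 * (Real.log Y / Real.log q) := by linarith
    calc ∑ p ∈ (Ioc ⌊a⌋₊ ⌊Y⌋₊).filter Nat.Prime, (χ.zetaMul p).re / p
        ≤ 100 * (Real.log Y / Real.log q) := hfin
      _ = (100 * η) * (Real.log Y / (η * Real.log q)) := by field_simp
      _ ≤ (100 * η₁) * (Real.log Y / (η * Real.log q)) := by gcongr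
      _ ≤ (2 * |K₁| + 100 * η₁) * Real.log Y / (η * Real.log q) := by
          rw [mul_div_assoc]; gcongr; linarith [abs_nonneg K₁]

/-- **Matomäki–Merikoski 2023, Lemma 4.1, second bound**: under the same hypotheses, "for any
`k ≥ 2`, one has `∑_{q^{(1/2+δ)/k} < p ≤ q^{(1/2+δ)/(k−1)}} λ(p)/p ≪_δ k/η^{1/k}`". PROVED from the
tree's Tao–Teräväinen Proposition 3.5 (3.14) (`SiegelZero.TaoTeravainen2021_eq314_holds`, `ε = 2δ`,
`m = k`), the bad range `10 ≤ η < η₀(δ)` again being trivial by Mertens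
(`log(log q^{c/(k−1)}/log q^{c/k}) = log(k/(k−1)) ≤ 1`). [cite: MatomakiMerikoski2023, Lemma 4.1] -/
theorem MatomakiMerikoski2023_lemma41_ii (δ : ℝ) (hδ : 0 < δ) :
    ∃ K : ℝ, 0 < K ∧ ∀ (q : ℕ) [NeZero q] (χ : DirichletCharacter ℂ q), χ.IsPrimitive →
      χ.IsQuadratic → ∀ η : ℝ, 10 ≤ η → χ.LFunction ((1 - 1 / (η * Real.log q) : ℝ) : ℂ) = 0 →
        ∀ k : ℕ, 2 ≤ k →
          ∑ p ∈ (Ioc ⌊(q : ℝ) ^ ((1 / 2 + δ) / k)⌋₊ ⌊(q : ℝ) ^ ((1 / 2 + δ) / (k - 1))⌋₊).filter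
              Nat.Prime, (χ.zetaMul p).re / p ≤ K * k / η ^ ((1 : ℝ) / k) := by
  obtain ⟨K₂, η₀, hTT⟩ := SiegelZero.TaoTeravainen2021_eq314_holds (2 * δ) (by positivity)
  set η₁ : ℝ := max η₀ 10 with hη₁
  have hη₁0 : 10 ≤ η₁ := le_max_right _ _
  refine ⟨2 * |K₂| + 25 * η₁, by positivity, ?_⟩
  intro q _ χ hprim hquad η hη hL k hk
  have hq2 : 2 ≤ q := SiegelZero.two_le_of_LFunction_eq_zero hL
  have hq1 : (1 : ℝ) < q := by exact_mod_cast hq2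
  have hq0 : (0 : ℝ) < q := by linarith
  have hlogq : 0 < Real.log q := Real.log_pos hq1
  have hχ2 : χ ^ 2 = 1 := MulChar.isQuadratic_iff_sq_eq_one.mp hquad
  have hη0 : 0 < η := by linarith
  have hη1 : 1 ≤ η := by linarith
  have hk2 : (2 : ℝ) ≤ k := by exact_mod_cast hk
  have hk0 : (0 : ℝ) < k := by linarith
  have hk1 : (0 : ℝ) < (k : ℝ) - 1 := by linarith
  set c : ℝ := 1 / 2 + δ with hc
  have hc0 : 0 < c := by positivity
  set a : ℝ := (q : ℝ) ^ (c / k) with ha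
  set b : ℝ := (q : ℝ) ^ (c / ((k : ℝ) - 1)) with hb
  have ha1 : 1 < a := Real.one_lt_rpow hq1 (by positivity)
  have hab : a ≤ b := by
    refine Real.rpow_le_rpow_of_exponent_le hq1.le ?_
    exact div_le_div_of_nonneg_left hc0.le hk1 (by linarith)
  have hpos : 0 < (k : ℝ) / η ^ ((1 : ℝ) / k) := by positivity
  by_cases hηlarge : η₁ ≤ η
  · -- Tao–Teräväinen (3.14)
    have h := hTT q χ hprim hquad η ((le_max_left _ _).trans hηlarge) hL k hk
    rw [show (1 + 2 * δ) / (2 * (k : ℝ)) = c / k by rw [hc]; ring,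
      show (1 + 2 * δ) / (2 * ((k : ℝ) - 1)) = c / ((k : ℝ) - 1) by
        rw [hc, div_eq_div_iff (mul_ne_zero two_ne_zero hk1.ne') hk1.ne']; ring] at h
    calc ∑ p ∈ (Ioc ⌊a⌋₊ ⌊b⌋₊).filter Nat.Prime, (χ.zetaMul p).re / p
        ≤ 2 * ∑ p ∈ SiegelZero.excPrimes χ (Ioc ⌊a⌋₊ ⌊b⌋₊), (1 : ℝ) / p :=
          sum_zetaMul_prime_div_le_two_mul_excPrimes χ hχ2 _
      _ ≤ 2 * (K₂ * k / η ^ ((1 : ℝ) / k)) := by gcongr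
      _ = 2 * K₂ * ((k : ℝ) / η ^ ((1 : ℝ) / k)) := by ring
      _ ≤ 2 * |K₂| * ((k : ℝ) / η ^ ((1 : ℝ) / k)) := by gcongr; exact le_abs_self K₂
      _ ≤ (2 * |K₂| + 25 * η₁) * k / η ^ ((1 : ℝ) / k) := by
          rw [mul_div_assoc (2 * |K₂| + 25 * η₁)]; gcongr; nlinarith
  · -- trivial range `10 ≤ η < η₁`
    push Not at hηlarge
    have htriv := sum_zetaMul_prime_div_window_le χ hχ2 ha1 hab
    have hlogab : Real.log b / Real.log a = (k : ℝ) / ((k : ℝ) - 1) := by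
      rw [ha, hb, Real.log_rpow hq0, Real.log_rpow hq0]
      field_simp
    have hratio : Real.log (Real.log b / Real.log a) ≤ 1 := by
      rw [hlogab]
      have h2 : (k : ℝ) / ((k : ℝ) - 1) ≤ 2 := by rw [div_le_iff₀ hk1]; linarith
      calc Real.log ((k : ℝ) / ((k : ℝ) - 1)) ≤ Real.log 2 :=
            Real.log_le_log (by positivity) h2
        _ ≤ 1 := by linarith [Real.log_two_lt_d9]
    have hfin : ∑ p ∈ (Ioc ⌊a⌋₊ ⌊b⌋₊).filter Nat.Prime, (χ.zetaMul p).re / p ≤ 50 := by linarith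
    -- `k/η^{1/k} ≥ 2/η₁`
    have hηk : η ^ ((1 : ℝ) / k) ≤ η₁ := by
      calc η ^ ((1 : ℝ) / k) ≤ η ^ (1 : ℝ) :=
            Real.rpow_le_rpow_of_exponent_le hη1 (by rw [div_le_one hk0]; linarith)
        _ = η := Real.rpow_one η
        _ ≤ η₁ := hηlarge.le
    have hlow : 2 / η₁ ≤ (k : ℝ) / η ^ ((1 : ℝ) / k) := by
      rw [div_le_div_iff₀ (by positivity) (by positivity)]
      nlinarith
    calc ∑ p ∈ (Ioc ⌊a⌋₊ ⌊b⌋₊).filter Nat.Prime, (χ.zetaMul p).re / p ≤ 50 := hfin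
      _ = (25 * η₁) * (2 / η₁) := by field_simp; ring
      _ ≤ (25 * η₁) * ((k : ℝ) / η ^ ((1 : ℝ) / k)) := by gcongr
      _ ≤ (2 * |K₂| + 25 * η₁) * k / η ^ ((1 : ℝ) / k) := by
          rw [mul_div_assoc (2 * |K₂| + 25 * η₁)]; gcongr; linarith [abs_nonneg K₂]

end Literature.Barriers.Parity
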